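import Mathlib.Analysis.SpecialFunctions.Pow.Real

/-!
# Route `ExcessDecayLiouville`: the uniform global gradient bound with general thresholds (definition)

Harmonic-replacement architecture for item `ExcessDecay` (stmt-AtomisticToContinuum-9334), nonlinear half.
`ntotGen κ r δ ε Du ja jb` is `ntotOf` (`ExcessDecayLiouvilleChainDefs`) with the thresholds `1/100` of the
sublattice jump and of the slope replaced by general uniform bounds `ja, jb`: the flux-smallness hypothesis of
`aux_gradient` (`4·10⁶ Λ ≤ κ/12`) needs them far below `1/100`, so the chain feeds its own budgets.
Pure bookkeeping (route-internal abbreviation of an explicit real number); `[folklore]`.  Nothing here closes an item.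
-/

noncomputable section

namespace Summit.AtomisticToContinuum.Crystallization.Theorems.ExcessDecayLiouville

/-- The uniform bound of the global near-neighbour energy `NN[χ·ũ, c₀, X]` of the cut-off displacement along the
chain (`global_gradient` with width `r/4` and the auxiliary bound `aux_gradient`), with the sublattice jump
`‖a 0 − a 1‖` and the slope `‖B‖` replaced by uniform bounds `ja`, `jb`. [folklore] -/
def ntotGen (κ r δ ε Du ja jb : ℝ) : ℝ :=
  2 * (40 * ((11 / 10) / (r / 4)) ^ 2) * (32 * (3 * r / 4 + 2) ^ 3 * Du ^ 2) +
    2 * (2 ^ (5 + 1) *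
        (((2 / κ * (19 * 16 * (1024 / ((23 / 25 : ℝ) ^ 3 * (23 / 25 : ℝ) ^ 3))) +
            16 * (11 / 10 : ℝ) ^ 8 * (1024 / ((23 / 25 : ℝ) ^ 3 * (23 / 25 : ℝ) ^ 3))) *
            (32 * (2 * (27 * r / 32)) ^ 3 * Du ^ 2) * (27 * r / 32 - 13 * r / 16) ^ 3 +
          2 / κ * (38 * 4 ^ 5 * (1024 / (23 / 25 : ℝ) ^ 3) * (32 * (2 * (27 * r / 32)) ^ 3 * Du ^ 2) +
            (210000 * ((25 / 23) * (2 * Du + ja) + jb)) * 20 ^ 5 * ((7 / 2) * (1024 / (23 / 25 : ℝ) ^ 3) *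
              (32 * (27 * r / 32) ^ 3 * Du ^ 2) + ((1024 / (23 / 25 : ℝ) ^ 3) * (32 * r ^ 3 * Du ^ 2)) / 2)) +
          120 ^ 5 * (160 * (32 * (27 * r / 32) ^ 3 * Du ^ 2))) / (27 * r / 32 - 13 * r / 16) ^ 5) +
      2 * (2 / κ * ((31488 * (1024 / ((23 / 25 : ℝ) ^ 3 * (r - 27 * r / 32) ^ 4)) + 2048 / (δ ^ 3 * (r - 27 * r / 32 - 2 * ε) ^ 4) +
          (38 * Du * (1024 / ((23 / 25 : ℝ) ^ 3 * (r / 32) ^ 5)) + 38 * Du * (1024 / ((23 / 25 : ℝ) ^ 3 * (r - 27 * r / 32) ^ 5)))) *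
            Du * (32 * (27 * r / 32) ^ 3) +
          (210000 * ((25 / 23) * (2 * Du + ja) + jb)) * (8192 * (27 * r / 32) ^ 3 * 0) / 2 +
          19 * 8192 * (27 * r / 32) ^ 3 * ((13 * r / 16)⁻¹ ^ 8 * (32 * r ^ 3 * Du ^ 2)))))

end Summit.AtomisticToContinuum.Crystallization.Theorems.ExcessDecayLiouville

end
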